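import Summits.BirchSwinnertonDyer.BirchSwinnertonDyer.Theorems.ThetaPartnerAtTwoSignedKatoUpToAtTwoPointsModelJ
import Literature.NumberTheory.EllipticCurves.H1CorestrictionIndexTwo
import Literature.NumberTheory.EllipticCurves.CyclotomicZpExtensionLocalGeneratorProofs
import HarnessLib

/-!
# Route `ThetaPartnerAtTwo` (TP2), crux K3 `SignedKatoDivisibilityUpToAtTwo` (item stmt-BirchSwinnertonDyer-20308),
# line `colemanrat` v3 — GALOIS EQUIVARIANCE OF THE POINTS-MODEL PAIRING and the `T`-ACTION ON `j`: for a local Galois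
# element `σ ∈ Γ_{K_v}` and a `σ`-stable `p`-saturated `A ≤ E(K_∞·K_v)`, the conjugate `conj_{res σ} c` of a Kummer-from-`A`
# class has witness `(σ·φ, σQ, k)`, so `J(φ_A)(conj_{res σ} c) = J(φ_A ∘ σ)(c)`; for `K = ℚ`, cyclotomic `κ` and a local lift
# `σ` of the generator `γ`: `T • j(φ_A) = j(φ_A ∘ σ − φ_A)` in the pinned dual `X^ε` — the `Λ`-LINEARITY of the points-model `j`
# in GENERATOR FORM (the tree has no `Λ`-module instance on `Hom(A, ℤ_p)`; Sprung's files phrase `Λ`-linearity the same way,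
# `ColemanMapLambdaActionProofs`: `T` acts on functionals through the twist by a local lift of `γ`).

Width seat `bsd-wall-tp2-p2x-w3` g2 (cell `bsd-wall`). HONEST FRAMING: THEOREMS ONLY — no definition, no named fact, no instance,
no `sorry`; route-independent; closes no item; BSD is NOT proved by any of this.

## What is proved

* §1 `conjH1_mem_localKummerOverOfEmb_of_smul_mem` — `Kummer(A)` is stable under `conj_{res σ}` for `σ ∈ Γ_{K_v}` with `σA ⊆ A`,
  with the explicit witness `(conjCocycle, σ • Q, k)` (`kummerWitness_conj`).
* §2 `kummerPairing_conj` — for any `J` with the value formula (`exists_kummerPairing`):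
  `J φ_A ⟨conj_{res σ} c, _⟩ = J (φ_A ∘ σ|_A) c`.
* §3 (`K = ℚ`, `κ` cyclotomic, `v ∋ p`, `σ ∈ Γ_{ℚ_v}` with `κ(res σ) = κ γ`) `toDual_X_smul_pointsModelJ` — for any `j` with the value
  formula of `exists_pointsModelJ`: `D.toDual (T • j φ_A) s = D.toDual (j (φ_A ∘ σ|_A − φ_A)) s` for all `s ∈ Sel^ε_∞`, hence
  `pointsModelJ_X_smul`: **`T • j φ_A = j (φ_A ∘ σ|_A) − j φ_A`**.

References: [Kobayashi2003] (7.17), (8.23) («compatible with the natural Galois action», p. 18); [Sprung2012] Def. 3.1, Def. 5.9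
(`Λ`-linearity via the twist); [SerreGaloisCohomology1997] I §2.5, I §5.1; [Washington1997] §13.1.
-/

set_option autoImplicit false
-- the Theorems namespace of this sub repeats the summit name by design (D-0017 nested layout)
set_option linter.dupNamespace false

noncomputable section

open scoped Classical

namespace Summit.BirchSwinnertonDyer.BirchSwinnertonDyer.Theorems

namespace SignedKatoOffTwo.KummerPoint

open NumberField IsDedekindDomain Field WeierstrassCurve
  Literature.NumberTheory.EllipticCurves Literature.NumberTheory.EllipticCurves.Kobayashi2003
  Literature.NumberTheory.EllipticCurves.GreenbergSelmer
  Literature.NumberTheory.EllipticCurves.Sprung2012 Literature.NumberTheory.GaloisRepresentations ZpExtension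

universe u

/-! ## §1 Conjugating a Kummer witness -/

section Conj

variable {K : Type u} [Field K] (W : WeierstrassCurve K) (p : ℕ) [Fact p.Prime] (κ : ZpExtension K p)
  {E : Type u} [Field E] [Algebra K E] (ι : AlgebraicClosure K →ₐ[K] AlgebraicClosure E)

/-- **The conjugate of a Kummer witness.** If `(φ, Q, k)` is a Kummer witness of a class relative to `A` and `σ ∈ Γ_{K_v}` with
`σ • (p^k Q) ∈ A`, then `(conj_{res σ} φ, σ • Q, k)` is a Kummer witness of the conjugate class:
`ι((res σ · φ)(res τ)) = τ(σQ) − σQ` on `Gal(K̄_v/K_∞·K_v)` (normality of the latter in `Γ_{K_v}` and `ι(res σ • x) = σ • ι x`).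
[cite: SerreGaloisCohomology1997, I §2.5] [cite: Kobayashi2003, §2 p. 4] -/
theorem kummerWitness_conj (σ : Field.absoluteGaloisGroup E)
    {φ : contOneCocycles (discreteTopRep κ.kerSubgroup (W.geomPrimaryTorsion p))} {Q : localPoints W E}
    (hτ : ∀ τ : localSubgroupOfEmb κ.kerSubgroup ι,
      pointsMapOfEmb W ι ((φ.1 (resGalSubgroupOfEmb κ.kerSubgroup ι τ) : W.geomPrimaryTorsion p) : W.geomPoints) =
        (τ : Field.absoluteGaloisGroup E) • Q - Q)
    (τ : localSubgroupOfEmb κ.kerSubgroup ι) :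
    pointsMapOfEmb W ι (((conjCocycle κ.kerSubgroup (resGalOfEmb ι σ) φ).1 (resGalSubgroupOfEmb κ.kerSubgroup ι τ) :
        W.geomPrimaryTorsion p) : W.geomPoints) =
      (τ : Field.absoluteGaloisGroup E) • (σ • Q) - σ • Q := by
  -- `σ⁻¹ τ σ` lies in the local group (normality)
  have hτ' : σ⁻¹ * (τ : Field.absoluteGaloisGroup E) * σ ∈ localSubgroupOfEmb κ.kerSubgroup ι := by
    rw [mem_localSubgroupOfEmb_iff, map_mul, map_mul, map_inv]
    exact κ.kerSubgroup_normal.conj_mem' _ ((mem_localSubgroupOfEmb_iff κ.kerSubgroup ι _).1 τ.2) _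
  have hconj : subgroupConj κ.kerSubgroup (resGalOfEmb ι σ) (resGalSubgroupOfEmb κ.kerSubgroup ι τ) =
      resGalSubgroupOfEmb κ.kerSubgroup ι ⟨σ⁻¹ * (τ : Field.absoluteGaloisGroup E) * σ, hτ'⟩ := by
    apply Subtype.ext
    rw [subgroupConj_apply_coe, resGalSubgroupOfEmb_apply_coe, resGalSubgroupOfEmb_apply_coe, map_mul, map_mul, map_inv]
  rw [conjCocycle_apply, hconj, primaryComponent.coe_smul, pointsMapOfEmb_smul, hτ ⟨_, hτ'⟩, smul_sub, smul_smul, smul_smul]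
  congr 1
  rw [show σ * (σ⁻¹ * (τ : Field.absoluteGaloisGroup E) * σ) = (τ : Field.absoluteGaloisGroup E) * σ by group, mul_smul]

/-- **`Kummer(A)` is stable under `conj_{res σ}`** for `σ ∈ Γ_{K_v}` with `σ • A ⊆ A`. [cite: SerreGaloisCohomology1997, I §2.5]
[cite: Kobayashi2003, Def. 1.1] -/
theorem conjH1_mem_localKummerOverOfEmb_of_smul_mem (A : AddSubgroup (localPoints W E))
    (σ : Field.absoluteGaloisGroup E) (hA : ∀ a ∈ A, σ • a ∈ A) {c : W.subgroupH1 p κ.kerSubgroup}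
    (hc : c ∈ localKummerOverOfEmb W p κ.kerSubgroup ι A) :
    W.conjH1 p κ.kerSubgroup (resGalOfEmb ι σ) c ∈ localKummerOverOfEmb W p κ.kerSubgroup ι A := by
  obtain ⟨φ, Q, k, rfl, hQ, hτ⟩ := hc
  refine ⟨conjCocycle κ.kerSubgroup (resGalOfEmb ι σ) φ, σ • Q, k, ?_, ?_, kummerWitness_conj W p κ ι σ hτ⟩
  · exact (conjH1_oneCocycleClass κ.kerSubgroup (resGalOfEmb ι σ) φ).symm
  · rw [smul_comm]; exact hA _ hQ

end Conj

/-! ## §2 Equivariance of the pairing -/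

section Equivariance

variable {K : Type u} [Field K] (W : WeierstrassCurve K) (p : ℕ) [Fact p.Prime] (κ : ZpExtension K p)
  {E : Type u} [Field E] [Algebra K E] (ι : AlgebraicClosure K →ₐ[K] AlgebraicClosure E)

/-- **`J(φ_A)(conj_{res σ} c) = J(φ_A ∘ σ|_A)(c)`** for every `J` with the value formula of `exists_kummerPairing` (the pairing
«is compatible with the natural Galois action», Kobayashi p. 18): the conjugate class has witness `(σ·φ, σQ, k)` and
`φ_A(p^k σQ) = (φ_A ∘ σ)(p^k Q)`. [cite: Kobayashi2003, §8.5 (p. 18)] [cite: SerreGaloisCohomology1997, I §2.5] -/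
theorem kummerPairing_conj (A : AddSubgroup (localPoints W E))
    (J : (A →+ ℤ_[p]) →+ (localKummerOverOfEmb W p κ.kerSubgroup ι A →+ AddCircle (1 : ℚ)))
    (hJ : ∀ (φA : A →+ ℤ_[p]) (c : localKummerOverOfEmb W p κ.kerSubgroup ι A)
        (φ : contOneCocycles (discreteTopRep κ.kerSubgroup (W.geomPrimaryTorsion p))) (Q : localPoints W E) (k : ℕ)
        (_ : oneCocycleClass _ φ = (c : W.subgroupH1 p κ.kerSubgroup)) (hQ : p ^ k • Q ∈ A)
        (_ : ∀ τ : localSubgroupOfEmb κ.kerSubgroup ι,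
          pointsMapOfEmb W ι ((φ.1 (resGalSubgroupOfEmb κ.kerSubgroup ι τ) : W.geomPrimaryTorsion p) : W.geomPoints) =
            (τ : Field.absoluteGaloisGroup E) • Q - Q),
        J φA c = (PadicInt.toZModPow k (φA ⟨p ^ k • Q, hQ⟩)).val • ((((p : ℚ) ^ k)⁻¹ : ℚ) : AddCircle (1 : ℚ)))
    (σ : Field.absoluteGaloisGroup E) (hA : ∀ a ∈ A, σ • a ∈ A) (φA : A →+ ℤ_[p])
    (c : localKummerOverOfEmb W p κ.kerSubgroup ι A) :
    J φA ⟨W.conjH1 p κ.kerSubgroup (resGalOfEmb ι σ) c,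
        conjH1_mem_localKummerOverOfEmb_of_smul_mem W p κ ι A σ hA c.2⟩ =
      J (φA.comp (((DistribSMul.toAddMonoidHom (localPoints W E) σ).comp A.subtype).codRestrict A
        (fun a ↦ hA a a.2))) c := by
  obtain ⟨φ, Q, k, hφ, hQ, hτ⟩ := (mem_localKummerOverOfEmb_iff A (c : W.subgroupH1 p κ.kerSubgroup)).1 c.2
  have hσQ : p ^ k • (σ • Q) ∈ A := by rw [smul_comm]; exact hA _ hQ
  have key : (φA.comp (((DistribSMul.toAddMonoidHom (localPoints W E) σ).comp A.subtype).codRestrict A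
      (fun a ↦ hA a a.2))) ⟨p ^ k • Q, hQ⟩ = φA ⟨p ^ k • (σ • Q), hσQ⟩ := by
    rw [AddMonoidHom.comp_apply]
    congr 1
    apply Subtype.ext
    show σ • (p ^ k • Q) = p ^ k • (σ • Q)
    rw [smul_comm]
  rw [hJ φA _ (conjCocycle κ.kerSubgroup (resGalOfEmb ι σ) φ) (σ • Q) k
      (by rw [← conjH1_oneCocycleClass, hφ]) hσQ (kummerWitness_conj W p κ ι σ hτ),
    hJ _ c φ Q k hφ hQ hτ, key]

end Equivariance

/-! ## §3 `K = ℚ`, cyclotomic `κ`: the `T`-action on the points-model `j` -/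

section Rat

variable (W : WeierstrassCurve ℚ) {p : ℕ} [Fact p.Prime] (κ : ZpExtension ℚ p) {γ : absoluteGaloisGroup ℚ} (ε : ℤˣ)

/-- For `K = ℚ`, cyclotomic `κ`, `v ∋ p`: a conjugation `conj_τ` with `κ τ = κ (res σ)` acts on `H¹(ℚ_∞, E[p^∞])` as `conj_{res σ}`
(`τ = res σ · h`, `h ∈ ker κ`, `conj_h = id`). [cite: Washington1997, §13.1] [cite: SerreGaloisCohomology1997, I §5.1] -/
theorem conjH1_eq_conjH1_resGalOfEmb (v : HeightOneSpectrum (𝓞 ℚ)) (σ : absoluteGaloisGroup (v.adicCompletion ℚ))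
    (τ : absoluteGaloisGroup ℚ) (hτ : κ τ = κ (resGalOfEmb (closureEmb (K := ℚ) (v.adicCompletion ℚ)) σ))
    (s : W.subgroupH1 p κ.kerSubgroup) :
    W.conjH1 p κ.kerSubgroup τ s = W.conjH1 p κ.kerSubgroup (resGalOfEmb (closureEmb (K := ℚ) (v.adicCompletion ℚ)) σ) s := by
  set δ := resGalOfEmb (closureEmb (K := ℚ) (v.adicCompletion ℚ)) σ
  have hh : δ⁻¹ * τ ∈ κ.kerSubgroup := by
    rw [ZpExtension.mem_kerSubgroup, map_mul, map_inv, hτ, inv_mul_cancel]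
  conv_lhs => rw [show τ = δ * (δ⁻¹ * τ) by rw [mul_inv_cancel_left]]
  rw [W.conjH1_mul_holds p κ.kerSubgroup, AddMonoidHom.comp_apply, W.conjH1_of_mem_holds p κ.kerSubgroup hh,
    AddMonoidHom.id_apply]

/-- **The `T`-action on the points-model `j` (generator form of `Λ`-linearity).** `K = ℚ`, `κ` cyclotomic with generator `γ`
(`κ γ = 1`... any `γ`), `v ∋ p`, `σ ∈ Γ_{ℚ_v}` a LOCAL LIFT with `κ(res σ) = κ γ` (exists: `exists_apply_resGalOfEmb_adicCompletion_eq`),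
`A^ε = ⨆ₙ E^ε_n` stable under `σ`. For every pinned `D : SignedSelmerDualData W κ γ ε`, every `j` with the value formula of
`exists_pointsModelJ`, every `φ_A` and `s ∈ Sel^ε_∞`:
`D.toDual (T • j φ_A) ⟨s, _⟩ = D.toDual (j (φ_A ∘ σ|_A)) ⟨s, _⟩ − D.toDual (j φ_A) ⟨s, _⟩`.
[cite: Kobayashi2003, §8.5 (p. 18)] [cite: Sprung2012, Def. 3.1 and Def. 5.9] -/
theorem toDual_X_smul_pointsModelJ (v : HeightOneSpectrum (𝓞 ℚ)) (hv : (p : 𝓞 ℚ) ∈ v.asIdeal)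
    (σ : absoluteGaloisGroup (v.adicCompletion ℚ)) (hσ : κ γ = κ (resGalOfEmb (closureEmb (K := ℚ) (v.adicCompletion ℚ)) σ))
    (hA : ∀ a ∈ (⨆ n, signedLocalPoints κ (v.adicCompletion ℚ) W ε n), σ • a ∈ (⨆ n, signedLocalPoints κ (v.adicCompletion ℚ) W ε n))
    (D : SignedSelmerDualData W κ γ ε)
    (j : (↥(⨆ n, signedLocalPoints κ (v.adicCompletion ℚ) W ε n) →+ ℤ_[p]) →+ D.X)
    (hj : ∀ (φA : ↥(⨆ n, signedLocalPoints κ (v.adicCompletion ℚ) W ε n) →+ ℤ_[p])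
        (s : W.subgroupH1 p κ.kerSubgroup) (hs : s ∈ signedSelmerInfty W κ ε)
        (φ : contOneCocycles (discreteTopRep κ.kerSubgroup (W.geomPrimaryTorsion p)))
        (Q : localPoints W (v.adicCompletion ℚ)) (k : ℕ)
        (_ : oneCocycleClass _ φ = s) (hQ : p ^ k • Q ∈ (⨆ n, signedLocalPoints κ (v.adicCompletion ℚ) W ε n))
        (_ : ∀ τ : localSubgroupOfEmb κ.kerSubgroup (closureEmb (K := ℚ) (v.adicCompletion ℚ)),
          pointsMapOfEmb W (closureEmb (K := ℚ) (v.adicCompletion ℚ))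
              ((φ.1 (resGalSubgroupOfEmb κ.kerSubgroup _ τ) : W.geomPrimaryTorsion p) : W.geomPoints) =
            (τ : absoluteGaloisGroup (v.adicCompletion ℚ)) • Q - Q),
        D.toDual (j φA) ⟨s, hs⟩ =
          (PadicInt.toZModPow k (φA ⟨p ^ k • Q, hQ⟩)).val • ((((p : ℚ) ^ k)⁻¹ : ℚ) : AddCircle (1 : ℚ)))
    (φA : ↥(⨆ n, signedLocalPoints κ (v.adicCompletion ℚ) W ε n) →+ ℤ_[p])
    (s : W.subgroupH1 p κ.kerSubgroup) (hs : s ∈ signedSelmerInfty W κ ε) :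
    D.toDual ((PowerSeries.X : IwasawaAlgebra p) • j φA) ⟨s, hs⟩ =
      D.toDual (j (φA.comp (((DistribSMul.toAddMonoidHom (localPoints W (v.adicCompletion ℚ)) σ).comp
        (⨆ n, signedLocalPoints κ (v.adicCompletion ℚ) W ε n).subtype).codRestrict
          (⨆ n, signedLocalPoints κ (v.adicCompletion ℚ) W ε n) (fun a ↦ hA a a.2)))) ⟨s, hs⟩ -
      D.toDual (j φA) ⟨s, hs⟩ := by
  rw [D.toDual_T_smul]
  congr 1
  -- the conjugate class and its witness
  have hs' : s ∈ localKummerOverOfEmb W p κ.kerSubgroup (closureEmb (K := ℚ) (v.adicCompletion ℚ))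
      (⨆ n, signedLocalPoints κ (v.adicCompletion ℚ) W ε n) :=
    SignedEC.signedSelmerInfty_le_localKummerOverOfEmb_iSup_signedLocalPoints W κ ε v hv hs
  obtain ⟨φ, Q, k, hφ, hQ, hτ⟩ := (mem_localKummerOverOfEmb_iff _ s).1 hs'
  have hσQ : p ^ k • (σ • Q) ∈ (⨆ n, signedLocalPoints κ (v.adicCompletion ℚ) W ε n) := by
    rw [smul_comm]; exact hA _ hQ
  have hconj : W.conjH1 p κ.kerSubgroup γ s =
      W.conjH1 p κ.kerSubgroup (resGalOfEmb (closureEmb (K := ℚ) (v.adicCompletion ℚ)) σ) s :=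
    conjH1_eq_conjH1_resGalOfEmb W κ v σ γ hσ s
  have hmem : W.conjH1 p κ.kerSubgroup γ s ∈ signedSelmerInfty W κ ε := D.conj_mem s hs
  have e1 : D.toDual (j φA) ⟨W.conjH1 p κ.kerSubgroup γ s, hmem⟩ =
      (PadicInt.toZModPow k (φA ⟨p ^ k • (σ • Q), hσQ⟩)).val • ((((p : ℚ) ^ k)⁻¹ : ℚ) : AddCircle (1 : ℚ)) :=
    hj φA _ hmem (conjCocycle κ.kerSubgroup (resGalOfEmb (closureEmb (K := ℚ) (v.adicCompletion ℚ)) σ) φ) (σ • Q) k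
      (by rw [← conjH1_oneCocycleClass, hφ, ← hconj]) hσQ (kummerWitness_conj W p κ _ σ hτ)
  have key : (φA.comp (((DistribSMul.toAddMonoidHom (localPoints W (v.adicCompletion ℚ)) σ).comp
      (⨆ n, signedLocalPoints κ (v.adicCompletion ℚ) W ε n).subtype).codRestrict
        (⨆ n, signedLocalPoints κ (v.adicCompletion ℚ) W ε n) (fun a ↦ hA a a.2))) ⟨p ^ k • Q, hQ⟩ =
      φA ⟨p ^ k • (σ • Q), hσQ⟩ := by
    rw [AddMonoidHom.comp_apply]
    congr 1
    apply Subtype.ext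
    show σ • (p ^ k • Q) = p ^ k • (σ • Q)
    rw [smul_comm]
  rw [e1, hj _ s hs φ Q k hφ hQ hτ, key]

end Rat

end SignedKatoOffTwo.KummerPoint

end Summit.BirchSwinnertonDyer.BirchSwinnertonDyer.Theorems

end
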